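import Summits.ResolutionOfSingularities.ResolutionOfSingularities.Theorems.FrobeniusLadderFInjectiveMacaulayficationWeightedSubstitution
import Mathlib.RingTheory.Localization.Away.Basic
import Mathlib.RingTheory.Ideal.Quotient.Operations
import HarnessLib

/-!
# The weighted blow-up chart embeds into the localized root cover
(crux `FInjectiveMacaulayfication`, line `Sketch`)

Support file for crux stmt-ResolutionOfSingularities-15315 (`FrobeniusLadder.FInjectiveMacaulayfication`,
line `Sketch`), stub `stub_weightedChartInjective` of the cycle-9 WEIGHTED CONE ENGINE (§15 of the
registered skeleton 10f06f91, #20). With the root-cover substitution `θ = θ_v` of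
`stub_weightedSubstitution` (`θ (X v) = X v ^ (w v)`, `θ (X j) = X j * X v ^ (w j)`), a hypersurface
`f` with `θ f = X v ^ D * g`, `g` weighted homogeneous of weight `-D` for the `ℤ/(w v)`-grading
`W v = 1`, `W j = -(w j)`, and any ring map
`Θ : (k[X]/(f))[x_v^{-c}] → (k[X]/(g))[x_v^{-1}]` compatible with `θ` on `k[X]`, the map `Θ` is injective.

Proof. If `Θ z = 0` with `z = [s]/x_v^{cm}`, then `x_v^t · θ s ∈ (g)`, say `X v ^ t * θ s = g * h`;
by the component rule `h` may be taken `W`-homogeneous of weight `t + D`; padding with `X v ^ t'`,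
`t + D + t' ≡ 0 (mod w v)`, gives a weight-`0` polynomial, which lifts: `X v ^ (w v * M) * X v ^ t' * h = θ H`;
hence `θ (X v ^ (M + t + D) * s) = θ (f * H)` and `θ` is injective, so `x_v ^ (M + t + D) [s] = 0` in
`k[X]/(f)` and `z = 0` (as `0 < c`). The hypotheses `c * w v = N` and `X v ∤ g` of the registered
signature are not used. [folklore]
-/

-- single-problem summit: the doubled namespace component is forced
set_option linter.dupNamespace false

namespace Summit.ResolutionOfSingularities.ResolutionOfSingularities.Theorems.FInjectiveMacaulayfication.WeightedChartInjective

open MvPolynomial Finsupp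
open Summit.ResolutionOfSingularities.ResolutionOfSingularities.Theorems.FInjectiveMacaulayfication.WeightedSubstitution

/-- **`stub_weightedChartInjective`** (registered signature, skeleton 10f06f91 of crux
stmt-ResolutionOfSingularities-15315): the chart map `Θ : (k[X]/(f))[x_v^{-c}] → (k[X]/(g))[x_v^{-1}]`
induced by the root-cover substitution `θ` (with `θ f = X v ^ D * g`, `g` weighted homogeneous of
weight `-D`) is injective. [folklore] -/
theorem stub_weightedChartInjective : ∀ (k : Type) [Field k] (n : ℕ) (w : Fin n → ℕ) (v : Fin n), 0 < w v →
    ∀ (N c D : ℕ), c * w v = N → 0 < c →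
    ∀ (f g : MvPolynomial (Fin n) k) (θ : MvPolynomial (Fin n) k →ₐ[k] MvPolynomial (Fin n) k),
    θ = MvPolynomial.aeval (fun j : Fin n => if j = v then (MvPolynomial.X v : MvPolynomial (Fin n) k) ^ (w v)
      else MvPolynomial.X j * MvPolynomial.X v ^ (w j)) →
    θ f = MvPolynomial.X v ^ D * g →
    MvPolynomial.IsWeightedHomogeneous (fun j : Fin n => if j = v then (1 : ZMod (w v)) else -((w j : ℕ) : ZMod (w v)))
      g (-((D : ℕ) : ZMod (w v))) →
    ¬ (MvPolynomial.X v : MvPolynomial (Fin n) k) ∣ g →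
    ∀ (Θ : Localization.Away (Ideal.Quotient.mk (Ideal.span {f}) (MvPolynomial.X v) ^ c) →+*
      Localization.Away (Ideal.Quotient.mk (Ideal.span {g}) (MvPolynomial.X v))),
    (∀ s : MvPolynomial (Fin n) k,
      Θ (algebraMap (MvPolynomial (Fin n) k ⧸ Ideal.span {f})
        (Localization.Away (Ideal.Quotient.mk (Ideal.span {f}) (MvPolynomial.X v) ^ c))
        (Ideal.Quotient.mk (Ideal.span {f}) s)) =
      algebraMap (MvPolynomial (Fin n) k ⧸ Ideal.span {g})
        (Localization.Away (Ideal.Quotient.mk (Ideal.span {g}) (MvPolynomial.X v)))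
        (Ideal.Quotient.mk (Ideal.span {g}) (θ s))) →
    Function.Injective Θ := by
  intro k _ n w v hv N c D _hN hc f g θ hθ hfg hg _hXg Θ hΘ
  subst hθ
  -- notation
  set W : Fin n → ZMod (w v) := fun j : Fin n => if j = v then (1 : ZMod (w v)) else -((w j : ℕ) : ZMod (w v))
    with hW
  set φ : MvPolynomial (Fin n) k →ₐ[k] MvPolynomial (Fin n) k := MvPolynomial.aeval
    (fun j : Fin n => if j = v then (MvPolynomial.X v : MvPolynomial (Fin n) k) ^ (w v)
      else MvPolynomial.X j * MvPolynomial.X v ^ (w j)) with hφ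
  set xf := Ideal.Quotient.mk (Ideal.span {f}) (MvPolynomial.X v) ^ c with hxf
  set xg := Ideal.Quotient.mk (Ideal.span {g}) (MvPolynomial.X v) with hxg
  have hφv : φ (X v) = X v ^ (w v) := by
    rw [hφ, aeval_X, if_pos rfl]
  obtain ⟨q, hq⟩ := Nat.exists_eq_add_one_of_ne_zero (Nat.pos_iff_ne_zero.1 hv)
  rw [injective_iff_map_eq_zero]
  intro z hz
  obtain ⟨a, m, rfl⟩ := IsLocalization.exists_mk'_eq (Submonoid.powers xf) z
  obtain ⟨s, rfl⟩ := Ideal.Quotient.mk_surjective a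
  -- `Θ [s] = 0`, i.e. `x_v ^ t θ(s) ∈ (g)`
  have h1 : algebraMap (MvPolynomial (Fin n) k ⧸ Ideal.span {g}) (Localization.Away xg)
      (Ideal.Quotient.mk (Ideal.span {g}) (φ s)) = 0 := by
    rw [← hΘ s, ← IsLocalization.mk'_spec (Localization.Away xf) (Ideal.Quotient.mk (Ideal.span {f}) s) m,
      map_mul, hz, zero_mul]
  obtain ⟨m', hm'⟩ := (IsLocalization.map_eq_zero_iff (Submonoid.powers xg) (Localization.Away xg) _).1 h1
  obtain ⟨t, ht⟩ := (Submonoid.mem_powers_iff _ _).1 m'.2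
  have ht' : X v ^ t * φ s ∈ Ideal.span {g} := by
    rw [← Ideal.Quotient.eq_zero_iff_mem, map_mul, map_pow, ← hxg, ht]
    exact hm'
  obtain ⟨h, hh⟩ := Ideal.mem_span_singleton'.1 ht'
  -- homogeneity bookkeeping
  have hWv : W v = 1 := by simp [hW]
  have hs0 : IsWeightedHomogeneous W (φ s) 0 := theta_isWeightedHomogeneous w v s
  have hXt : IsWeightedHomogeneous W (X v ^ t * φ s) ((t : ℕ) : ZMod (w v)) := by
    have h2 := ((isWeightedHomogeneous_X k W v).pow t).mul hs0
    rw [hWv, add_zero, nsmul_eq_mul, mul_one] at h2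
    exact h2
  -- component rule: `X v ^ t * φ s = g * h'` with `h'` homogeneous of weight `t + D`
  set h' := weightedHomogeneousComponent W (((t : ℕ) : ZMod (w v)) - -((D : ℕ) : ZMod (w v))) h with hh'
  have hcomp : X v ^ t * φ s = g * h' := by
    rw [hh', ← weightedHomogeneousComponent_mul_of_isWeightedHomogeneous hg h, mul_comm g h, hh]
    exact (hXt.weightedHomogeneousComponent_same).symm
  have hh'hom : IsWeightedHomogeneous W h' (((t : ℕ) : ZMod (w v)) - -((D : ℕ) : ZMod (w v))) :=
    weightedHomogeneousComponent_isWeightedHomogeneous _ h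
  -- pad to weight `0`
  have hwt : (((q * (t + D) : ℕ) : ZMod (w v))) + ((((t : ℕ) : ZMod (w v))) - -((D : ℕ) : ZMod (w v))) = 0 := by
    have e1 : (((q * (t + D) : ℕ) : ZMod (w v))) + ((((t : ℕ) : ZMod (w v))) - -((D : ℕ) : ZMod (w v))) =
        (((q + 1) * (t + D) : ℕ) : ZMod (w v)) := by
      push_cast
      ring
    rw [e1, ← hq, Nat.cast_mul, ZMod.natCast_self, zero_mul]
  have hU : IsWeightedHomogeneous W (X v ^ (q * (t + D)) * h') 0 := by
    have h2 := ((isWeightedHomogeneous_X k W v).pow (q * (t + D))).mul hh'hom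
    rw [hWv, nsmul_eq_mul, mul_one, hwt] at h2
    exact h2
  obtain ⟨M, H, hMH⟩ := exists_pow_mul_eq_theta w v hv (X v ^ (q * (t + D)) * h') hU
  -- the key identity upstairs
  have hexp : w v * (M + t + D) = D + w v * M + q * (t + D) + t := by
    rw [hq]
    ring
  have key : φ (X v ^ (M + t + D) * s) = φ (f * H) := by
    calc φ (X v ^ (M + t + D) * s) = X v ^ (w v * (M + t + D)) * φ s := by
          rw [map_mul, map_pow, hφv, ← pow_mul]
      _ = X v ^ (D + w v * M + q * (t + D)) * (X v ^ t * φ s) := by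
          rw [← mul_assoc, ← pow_add, hexp]
      _ = X v ^ (D + w v * M + q * (t + D)) * (g * h') := by rw [hcomp]
      _ = X v ^ D * g * (X v ^ (w v * M) * (X v ^ (q * (t + D)) * h')) := by ring
      _ = φ (f * H) := by rw [map_mul, hfg, hMH]
  have hinj : X v ^ (M + t + D) * s = f * H := theta_injective w v hv key
  -- downstairs: `x_v ^ (M + t + D) [s] = 0`, hence `z = 0`
  have hzero : Ideal.Quotient.mk (Ideal.span {f}) (X v) ^ (M + t + D) *
      Ideal.Quotient.mk (Ideal.span {f}) s = 0 := by
    rw [← map_pow, ← map_mul, hinj, map_mul,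
      Ideal.Quotient.eq_zero_iff_mem.2 (Ideal.mem_span_singleton_self f), zero_mul]
  rw [IsLocalization.mk'_eq_zero_iff]
  obtain ⟨c', hc'⟩ := Nat.exists_eq_add_one_of_ne_zero (Nat.pos_iff_ne_zero.1 hc)
  refine ⟨⟨xf ^ (M + t + D), (M + t + D), rfl⟩, ?_⟩
  show xf ^ (M + t + D) * Ideal.Quotient.mk (Ideal.span {f}) s = 0
  have hsplit : xf ^ (M + t + D) = Ideal.Quotient.mk (Ideal.span {f}) (X v) ^ (c' * (M + t + D)) *
      Ideal.Quotient.mk (Ideal.span {f}) (X v) ^ (M + t + D) := by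
    rw [hxf, ← pow_mul, ← pow_add, hc']
    congr 1
    ring
  rw [hsplit, mul_assoc, hzero, mul_zero]

end Summit.ResolutionOfSingularities.ResolutionOfSingularities.Theorems.FInjectiveMacaulayfication.WeightedChartInjective
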